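import Summits.QuantumFields.YangMills.Theorems.BalabanUVNodesN15CurvedGluingLocalGaugesSpeciesUN
import Summits.QuantumFields.YangMills.Theorems.BalabanUVNodesN15SmallFieldAxialGaugeUN
import Literature.MathematicalPhysics.QuantumFieldTheory.Balaban1983to89.B9Eq335RegularityClasses
import Literature.MathematicalPhysics.QuantumFieldTheory.Balaban1983to89.B9Eq335Plaquette
import Literature.MathematicalPhysics.QuantumFieldTheory.Balaban1983to89.B9Eq335PureGaugeInClassAtLettersY
import HarnessLib

/-!
# Route «BalabanUVNodes» (cluster K4 «SpineRates»), Track-A DAG node N15 = NE2, BACKGROUND LAYER — PRINT's REGULARITY CLASS (3.35) BY NAME FEEDS THE `U(N)` CUBE DEVICE: on a cube of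
# lit-balaban r06's class `Reg335Cube` («there exists a gauge transformation u on □ such that U^u = e^{iηA} … |A| < Cξ⁻¹, |∇^ηA| < Cξ⁻² on □») the class's own gauge `u` is UNITARY
# and BOTH group-level bond letters hold in it — `‖U^u(b) − 1‖ ≤ η·(C∕ξ)e^{ηC∕ξ}` AND `‖U^u_ν(z + e_κ) − U^u_ν(z)‖ ≤ η²·(C∕ξ²)e^{ηC∕ξ}` —, so g5 FILE 11's perturbation letter `hV` for the
# local species of `U^u` holds with its displayed SECOND letter DISCHARGED

Cell `pub-ymgap`, seat `pub-ymgap-dag-n15-w2` (WIDTH SEAT 2∕3 on node N15, director-ym №197 ∕ HUMAN RULING D-0149), g6, first piece (bus CLAIM-1 I.39514).  `bears_on: R4∕N15 · K3⁸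
SpineGivenEndpointR13SepCoPHV (stmt-QuantumFields-27366)`.  Filed `--kind proof --supports stmt-QuantumFields-27366 --as helper` — COUNT-NEUTRAL.  Theorems only; 0 `def`, 0 `sorry`.
Imports BY NAME this seat's g5 FILE 11 `…CurvedGluingLocalGaugesSpeciesUN` (`uN_hasMaj_localSpecies_rate`; through it `trGaugeActFwd`, `gaugePair`, `tCoefC`∕`tCoefA`, `unstackM`,
`curvRowLetter`), g5 FILE 3 `…SmallFieldAxialGaugeUN` (`frobenius_norm_le_sqrt_card_mul_l2_opNorm`), lit-balaban r06 `B9Eq335RegularityClasses` (`Reg335Cube`,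
`norm_le_eta_mul_of_norm_inv_smul_lt`; through it `B9Eq3117Current.gaugeTr`, `B9Eq39Adjoint.fluct`∕`covD`), `B9Eq335Plaquette` (`norm_exp_sub_one_le_mul`, `norm_exp_sub_exp_le_of_le`),
`B9Eq335PureGaugeInClassAtLettersY` (`reg335Cube_gaugeTr_one`, the A6 witness) and Mathlib's C⋆-structure of `M_n(ℂ)` (`Matrix.toEuclideanCLM`, `Matrix.instL2OpNormedRing`,
`ContinuousLinearMap.norm_map_iff_adjoint_comp_self`); nothing in the tree is modified, no landed name re-declared.

WHY.  The per-cube road of this lineage at `G = U(N)` reads «(3.35) gauge on the cube [hypothesis] → species letter in that gauge (g5 FILE 2) → local parametrix (n15-w3 files 34–45) →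
gluing across gauges (g5 FILES 7–11)».  Its entrance, g5 FILE 11 `uN_hasMaj_localSpecies_rate`, takes the cube gauge `u` and TWO bond-variable letters in that gauge as hypotheses:
`‖U^u_μ(x) − 1‖_F ≤ ηa` — produced by g5 FILES 3∕4 from plaquette smallness in the axial gauge — and `‖U^u_μ(x) − U^u_μ(x − e_μ)‖_F ≤ η²b`, which g5 left DISPLAYED («needs the smooth
Sect.-F gauge»).  In print both letters are ONE hypothesis: [Balaban1985BackgroundPropagators] (3.35) p. 396 *«for an arbitrary cube □ of the described above class, and for a
configuration U there exists a gauge transformation u on □ such that U^u = e^{iηA}. and if the index of □ is j, then |A| < O(1)Mα₀(Lʲη)⁻¹, |∇^ηA| < O(1)Mα₀(Lʲη)⁻² on □»*, consumed by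
Thm 3.1 p. 397 *«for an arbitrary configuration U satisfying the regularity condition (3.35)»* and by Cor. 3.6 p. 408 *«Applying the gauge transformation u we get U′ = U^u = e^{iηA} with A
satisfying the inequalities in (3.35) … This implies that U′ satisfies (3.37) … with U = 1»*.  The tree HAS this class as a predicate with body — lit-balaban r06's
`B9Eq335RegularityClasses.Reg335Cube T U η □ ξ C` (gauge `u` of unitary type `‖u‖, ‖u⁻¹‖ ≤ 1`, `U^u = e^{iηA}` on □, `‖A‖ < Cξ⁻¹`, `‖η⁻¹D¹_κA_ν‖ < Cξ⁻²` on □, ALL directions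
`κ, ν`) —, consumed by the [B9]∕[B13] Literature files of nodes N06∕N10 but by NO N15 file before this one.  THIS FILE makes the class the entrance of the per-cube road:
* §0 ★ `uN_mem_unitaryGroup_of_norm_le_one` — a unit of `M_n(ℂ)` with `‖u‖_{op} ≤ 1`, `‖u⁻¹‖_{op} ≤ 1` (Mathlib's L²-operator norm) IS unitary (the converse of the tree's
  `mem_U1_of_unitary`): `x ↦ ux` is an isometry of `ℂⁿ`, so `uᴴu = 1` by `ContinuousLinearMap.norm_map_iff_adjoint_comp_self` through the ⋆-algebra equivalence `Matrix.toEuclideanCLM`.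
  Hence the class's «u of unitary type» IS a `U(n)` gauge when `𝔸 = M_n(ℂ)` carries the operator norm (the norm of the tree's [B9]∕[B13] matrix instances).
* §1 (ANY complete normed ℂ-algebra with `‖1‖ = 1`) `val_fluct` (`(e^{iηA})(b) = exp(iη·A(b))`), ★★ `bondLetters_of_gauge335` — for a gauge datum `(u, A)` AS IN THE CLASS (the four
  clauses as binders, `u`, `A` free, so a consumer's OWN per-cube gauge is served): FIRST LETTER `‖U^u_κ(z) − 1‖ ≤ η·(C∕ξ)·e^{ηC∕ξ}` on □ (`‖e^X − 1‖ ≤ ‖X‖e^{‖X‖}`, `X = iηA_κ(z)`,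
  `‖X‖ ≤ ηC∕ξ`), SECOND LETTER `‖U^u_ν(z + e_κ) − U^u_ν(z)‖ ≤ η²·(C∕ξ²)·e^{ηC∕ξ}` for ALL `κ, ν` with `z, z + e_κ ∈ □` (`e^{X′} − e^X` is `e^{ηC∕ξ}`-Lipschitz on the ball,
  `X′ − X = iη·(A_ν(z + e_κ) − A_ν(z)) = iη·D¹_κA_ν(z)`, `‖D¹_κA_ν‖ ≤ η·Cξ⁻²`); ★★ `exists_gauge_bondLetters_of_reg335Cube` (the ∃-form from `Reg335Cube` BY NAME).
* §2 (`𝔸 = M_n(ℂ)`, operator norm, `U(n)`-valued `U`) `uN_val_inv_eq_conjTranspose`, `uN_val_gaugeTr_eq` (`U^u_κ(z) = u(z)U_κ(z)u(z + e_κ)ᴴ` in a unitary gauge — FILE 11's currency),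
  ★★ `uN_opLetters_of_gauge335` ∕ ★★ `uN_exists_gauge_opLetters_of_reg335Cube` (unitary `u` on □ by §0 + both letters).
* §3 ★★★ `uN_hasMaj_localSpecies_rate_of_gauge335` ∕ ★★★ **`uN_exists_gauge_hasMaj_localSpecies_rate_of_reg335Cube`** — THE JUNCTION: a `U(n)`-valued bond field on the cube
  device's carrier in the class (□ := the carrier, scale `ξ`, constant `C`) ⟹ in the class's own (unitary) gauge the local species `unstackM (tCoefC η Rp) (tCoefA η Rp)` of `U^u`
  obeys g5 FILE 11's `hV` letter for EVERY `δ_V` with `a := √|n|·(C∕ξ)e^{ηC∕ξ}`, `b := √|n|·(C∕ξ²)e^{ηC∕ξ}` (`‖·‖_F ≤ √|n|·‖·‖_{op}`, g5 FILE 3; then FILE 11 verbatim) — FILE 11's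
  displayed second letter DISCHARGED; the class is the only hypothesis, as in Thm 3.1.
* §4 (A6, NON-VACUITY) `uN_exists_gauge_hasMaj_localSpecies_rate_pureGauge` — every PURE GAUGE `U = (1)^v`, `v` unitary, is in the class for all `ξ, C > 0` (r06
  `reg335Cube_gaugeTr_one` BY NAME), so the junction's hypothesis set is inhabited by genuine non-constant `U(n)` configurations.

HONEST FRAMING ∕ LIMITS.  Exponential-map bookkeeping over a Literature PREDICATE WITH BODY ((3.35) p. 396 as typed by r06; the cube family, the scale `ξ = Lʲη` and the constant
`C = O(1)Mα₀` are parameters) + finite-dimensional linear algebra; the norms are related crudely (`√|n|`).  The class (3.35) is a HYPOTHESIS exactly as in [B9] Thm 3.1; its PRODUCTION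
from small plaquette variables ([Balaban1985RegularSpaces] = node N04; r06 `B9Eq335AxialCriterion`) is NOT claimed here, and the carrier-level bookkeeping (restriction of a torus
configuration to a cube window, the knit) is the consumer's.  Nothing of [B5]∕[B6]∕[B9] asserted beyond cited shapes; NE2⁺ NOT PRINTED ∕ NOT proved; N15 NOT discharged; K3⁸ OPEN,
skeleton v6 untouched (0∕2); counts of record UNMOVED (typed 28∕28 · discharged 5∕27 · A 5∕28); one finite 𝕋⁴ at fixed ε — NOT ℝ⁴ ∕ OS ∕ mass gap ∕ Clay; R4 closes the conditional
finite-𝕋⁴ rung `BalabanLadder.UV` only.  Restate-immune (no Theses import).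
-/

set_option autoImplicit false

noncomputable section
open scoped BigOperators Matrix

namespace Summit.QuantumFields.YangMills.BalabanUVNodes.N15.CurvedSpecies

/-! ## §0 A unit of `M_n(ℂ)` contracting in both directions (operator norm) is unitary -/

section UnitaryOfU1

open scoped Matrix.Norms.L2Operator

variable {n : Type} [Fintype n] [DecidableEq n]

/-- ★ **`U1 ⊆ U(n)` FOR MATRICES** (the converse of the tree's `mem_U1_of_unitary`): a unit `u` of `M_n(ℂ)` with `‖u‖_{op} ≤ 1` and `‖u⁻¹‖_{op} ≤ 1` (the L²-operator norm,
`Matrix.instL2OpNormedRing`) is UNITARY — `ℂⁿ ∋ x ↦ ux` is an isometry (`‖x‖ = ‖u⁻¹(ux)‖ ≤ ‖ux‖ ≤ ‖x‖`), hence `uᴴu = 1` (`ContinuousLinearMap.norm_map_iff_adjoint_comp_self` through the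
⋆-algebra equivalence `Matrix.toEuclideanCLM`).  So the gauge `u` «of unitary type» of r06's `Reg335Cube` IS a `U(n)` gauge when `𝔸 = M_n(ℂ)`. [folklore] -/
theorem uN_mem_unitaryGroup_of_norm_le_one (u : (Matrix n n ℂ)ˣ) (h1 : ‖(u : Matrix n n ℂ)‖ ≤ 1) (h2 : ‖(((u⁻¹ : (Matrix n n ℂ)ˣ)) : Matrix n n ℂ)‖ ≤ 1) :
    (u : Matrix n n ℂ) ∈ Matrix.unitaryGroup n ℂ := by
  set T : EuclideanSpace ℂ n →L[ℂ] EuclideanSpace ℂ n := Matrix.toEuclideanCLM (n := n) (𝕜 := ℂ) (u : Matrix n n ℂ) with hT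
  set T' : EuclideanSpace ℂ n →L[ℂ] EuclideanSpace ℂ n := Matrix.toEuclideanCLM (n := n) (𝕜 := ℂ) (((u⁻¹ : (Matrix n n ℂ)ˣ)) : Matrix n n ℂ) with hT'
  have hTn : ‖T‖ ≤ 1 := by rwa [hT, ← Matrix.cstar_norm_def]
  have hT'n : ‖T'‖ ≤ 1 := by rwa [hT', ← Matrix.cstar_norm_def]
  have hprod : T' * T = 1 := by
    rw [hT, hT', ← map_mul, Units.inv_mul, map_one]
  have hTT : ∀ x, T' (T x) = x := fun x => by
    rw [← ContinuousLinearMap.comp_apply, ← ContinuousLinearMap.mul_def, hprod]; rfl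
  have hiso : ∀ x, ‖T x‖ = ‖x‖ := fun x => by
    refine le_antisymm ((T.le_opNorm x).trans ?_) ?_
    · calc ‖T‖ * ‖x‖ ≤ 1 * ‖x‖ := by gcongr
        _ = ‖x‖ := one_mul _
    · calc ‖x‖ = ‖T' (T x)‖ := by rw [hTT]
        _ ≤ ‖T'‖ * ‖T x‖ := T'.le_opNorm _
        _ ≤ 1 * ‖T x‖ := by gcongr
        _ = ‖T x‖ := one_mul _
  have hadj : ContinuousLinearMap.adjoint T ∘L T = 1 := (ContinuousLinearMap.norm_map_iff_adjoint_comp_self T).mp hiso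
  have hstar : Matrix.toEuclideanCLM (n := n) (𝕜 := ℂ) (star (u : Matrix n n ℂ) * (u : Matrix n n ℂ)) =
      Matrix.toEuclideanCLM (n := n) (𝕜 := ℂ) 1 := by
    rw [map_mul, map_star, map_one, ContinuousLinearMap.star_eq_adjoint, ContinuousLinearMap.mul_def, ← hT, hadj]
  exact Matrix.mem_unitaryGroup_iff'.mpr (Matrix.toEuclideanCLM.injective hstar)

end UnitaryOfU1

/-! ## §1 The class (3.35) on a cube ⟹ BOTH group-level bond letters in the class's gauge (any complete normed ℂ-algebra with `‖1‖ = 1`) -/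

section Generic

open NormedSpace
open Literature.MathematicalPhysics.QuantumFieldTheory.Balaban1983to89
open Literature.MathematicalPhysics.QuantumFieldTheory.Balaban1983to89.B9Eq39Adjoint (covD fluct)
open Literature.MathematicalPhysics.QuantumFieldTheory.Balaban1983to89.B9Eq3117Current (gaugeTr)
open Literature.MathematicalPhysics.QuantumFieldTheory.Balaban1983to89.B9Eq335RegularityClasses (Reg335Cube norm_le_eta_mul_of_norm_inv_smul_lt)
open Literature.MathematicalPhysics.QuantumFieldTheory.Balaban1983to89.B9Eq335Plaquette (norm_exp_sub_one_le_mul norm_exp_sub_exp_le_of_le)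
open Literature.MathematicalPhysics.QuantumFieldTheory.Balaban1983to89.B9Eq37Insertion (val_holU)
open Literature.MathematicalPhysics.QuantumFieldTheory.Balaban1983to89.Beta.TransportVertices (holonomy_cons holonomy_nil)

variable {𝔸 : Type*} [NormedRing 𝔸] [NormedAlgebra ℂ 𝔸] [CompleteSpace 𝔸] [NormOneClass 𝔸] {S ι : Type*}
  (T : ι → Equiv.Perm S) (U : ι → S → 𝔸ˣ)

omit [NormOneClass 𝔸] in
/-- The value of the fluctuation unit: `(e^{iηA})(b) = exp(iη·A(b))` (r06's `fluct`, a one-letter ordered product of exponentials). [cite: Balaban1985BackgroundPropagators, p.390 («U′ = exp iηA»)] -/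
theorem val_fluct (η : ℝ) (A : ι → S → 𝔸) (κ : ι) (z : S) : (fluct η A κ z : 𝔸) = exp ((Complex.I * η : ℂ) • A κ z) := by
  rw [fluct, val_holU, holonomy_cons, holonomy_nil, mul_one]

omit [NormedAlgebra ℂ 𝔸] [CompleteSpace 𝔸] [NormOneClass 𝔸] in
/-- The flat forward difference: `D¹_{1,κ} f (z) = f(z + e_κ) − f(z)` (r06's `covD` at the trivial transport). [cite: Balaban1985BackgroundPropagators, (3.3) p.391 (at `U = 1`)] -/
theorem covD_one_apply' (κ : ι) (f : S → 𝔸) (z : S) : covD T (fun _ _ => (1 : 𝔸ˣ)) κ f z = f (T κ z) - f z := by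
  simp [covD, B9Eq39Adjoint.R]

omit [CompleteSpace 𝔸] [NormOneClass 𝔸] in
/-- `‖iη·a‖ = η‖a‖` for `η ≥ 0`. [folklore] -/
theorem norm_I_eta_smul {η : ℝ} (hη : 0 ≤ η) (a : 𝔸) : ‖(Complex.I * η : ℂ) • a‖ = η * ‖a‖ := by
  rw [norm_smul, norm_mul, Complex.norm_I, one_mul, Complex.norm_real, Real.norm_of_nonneg hη]

/-- ★★ **BOTH BOND LETTERS FOR A GAUGE DATUM `(u, A)` AS IN THE CLASS (3.35)** — the class's clauses as binders, `u` and `A` FREE (so a consumer's own per-cube gauge is served):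
`U^u = e^{iηA}` on □, `‖A_κ‖ < Cξ⁻¹` on □, `‖η⁻¹D¹_κA_ν‖ < Cξ⁻²` on □, `η > 0` ⟹ FIRST LETTER `‖U^u_κ(z) − 1‖ ≤ η·(C∕ξ)·e^{ηC∕ξ}` on □ (`‖e^X − 1‖ ≤ ‖X‖e^{‖X‖}`
at `X = iηA_κ(z)`, `‖X‖ ≤ ηC∕ξ`) AND SECOND LETTER `‖U^u_ν(z + e_κ) − U^u_ν(z)‖ ≤ η²·(C∕ξ²)·e^{ηC∕ξ}` for ALL directions `κ, ν` whenever `z, z + e_κ ∈ □` (`e^{X′} − e^X` is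
`e^{ηC∕ξ}`-Lipschitz on the ball of radius `ηC∕ξ`, `X′ − X = iη·(A_ν(z + e_κ) − A_ν(z)) = iη·D¹_κA_ν(z)`, `‖D¹_κA_ν(z)‖ ≤ η·Cξ⁻²`).
[cite: Balaban1985BackgroundPropagators, (3.35) p.396, Cor. 3.6 p.408 («U′ = U^u = e^{iηA} … This implies that U′ satisfies (3.37) … with U = 1»)] -/
theorem bondLetters_of_gauge335 {η : ℝ} (hη : 0 < η) {cube : Set S} {ξ C : ℝ} {u : S → 𝔸ˣ} {A : ι → S → 𝔸}
    (hg : ∀ κ, ∀ z ∈ cube, gaugeTr T u U κ z = fluct η A κ z) (hA : ∀ κ, ∀ z ∈ cube, ‖A κ z‖ < C * ξ⁻¹)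
    (hD : ∀ κ ν, ∀ z ∈ cube, ‖((η : ℂ)⁻¹) • covD T (fun _ _ => (1 : 𝔸ˣ)) κ (A ν) z‖ < C * (ξ ^ 2)⁻¹) :
    (∀ κ, ∀ z ∈ cube, ‖(gaugeTr T u U κ z : 𝔸) - 1‖ ≤ η * (C / ξ) * Real.exp (η * (C / ξ))) ∧
      (∀ κ ν, ∀ z ∈ cube, T κ z ∈ cube →
        ‖(gaugeTr T u U ν (T κ z) : 𝔸) - gaugeTr T u U ν z‖ ≤ η ^ 2 * (C / ξ ^ 2) * Real.exp (η * (C / ξ))) := by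
  -- the exponent letters on the cube
  have hX : ∀ κ, ∀ z ∈ cube, ‖(Complex.I * η : ℂ) • A κ z‖ ≤ η * (C / ξ) := fun κ z hz => by
    rw [norm_I_eta_smul hη.le]
    exact mul_le_mul_of_nonneg_left (by rw [div_eq_mul_inv]; exact (hA κ z hz).le) hη.le
  have hval : ∀ κ, ∀ z ∈ cube, (gaugeTr T u U κ z : 𝔸) = exp ((Complex.I * η : ℂ) • A κ z) := fun κ z hz => by
    rw [hg κ z hz, val_fluct]
  refine ⟨fun κ z hz => ?_, fun κ ν z hz hz' => ?_⟩
  · rw [hval κ z hz]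
    -- `t ↦ t·eᵗ` is monotone on `t ≥ 0`
    exact (norm_exp_sub_one_le_mul _).trans
      (mul_le_mul (hX κ z hz) (Real.exp_le_exp.mpr (hX κ z hz)) (Real.exp_pos _).le ((norm_nonneg _).trans (hX κ z hz)))
  · rw [hval ν (T κ z) hz', hval ν z hz]
    refine (norm_exp_sub_exp_le_of_le _ _ (hX ν (T κ z) hz') (hX ν z hz)).trans ?_
    have hdiff : (Complex.I * η : ℂ) • A ν (T κ z) - (Complex.I * η : ℂ) • A ν z =
        (Complex.I * η : ℂ) • covD T (fun _ _ => (1 : 𝔸ˣ)) κ (A ν) z := by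
      rw [covD_one_apply', smul_sub]
    have hcov : ‖covD T (fun _ _ => (1 : 𝔸ˣ)) κ (A ν) z‖ ≤ η * (C * (ξ ^ 2)⁻¹) := norm_le_eta_mul_of_norm_inv_smul_lt hη (hD κ ν z hz)
    rw [hdiff, norm_I_eta_smul hη.le]
    calc η * ‖covD T (fun _ _ => (1 : 𝔸ˣ)) κ (A ν) z‖ * Real.exp (η * (C / ξ))
        ≤ η * (η * (C * (ξ ^ 2)⁻¹)) * Real.exp (η * (C / ξ)) := by gcongr
      _ = η ^ 2 * (C / ξ ^ 2) * Real.exp (η * (C / ξ)) := by rw [div_eq_mul_inv]; ring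

/-- ★★ **THE CLASS (3.35) ON A CUBE, BY NAME ⟹ BOTH BOND LETTERS IN THE CLASS's GAUGE** (∃-form of `bondLetters_of_gauge335`): `Reg335Cube T U η □ ξ C` (r06: «there exists a gauge
transformation u on □ such that U^u = e^{iηA} … |A| < Cξ⁻¹, |∇^ηA| < Cξ⁻² on □»), `η > 0` ⟹ there is `u` of unitary type on □ (`‖u‖, ‖u⁻¹‖ ≤ 1`, the class's gauge) with
`‖U^u_κ(z) − 1‖ ≤ η·(C∕ξ)·e^{ηC∕ξ}` on □ and `‖U^u_ν(z + e_κ) − U^u_ν(z)‖ ≤ η²·(C∕ξ²)·e^{ηC∕ξ}` for all `κ, ν` whenever `z, z + e_κ ∈ □`.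
[cite: Balaban1985BackgroundPropagators, (3.35) p.396, Cor. 3.6 p.408] -/
theorem exists_gauge_bondLetters_of_reg335Cube {η : ℝ} (hη : 0 < η) {cube : Set S} {ξ C : ℝ}
    (h : Reg335Cube T U η cube ξ C) :
    ∃ u : S → 𝔸ˣ, (∀ z ∈ cube, ‖(u z : 𝔸)‖ ≤ 1 ∧ ‖(((u z)⁻¹ : 𝔸ˣ) : 𝔸)‖ ≤ 1) ∧
      (∀ κ, ∀ z ∈ cube, ‖(gaugeTr T u U κ z : 𝔸) - 1‖ ≤ η * (C / ξ) * Real.exp (η * (C / ξ))) ∧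
      (∀ κ ν, ∀ z ∈ cube, T κ z ∈ cube →
        ‖(gaugeTr T u U ν (T κ z) : 𝔸) - gaugeTr T u U ν z‖ ≤ η ^ 2 * (C / ξ ^ 2) * Real.exp (η * (C / ξ))) := by
  obtain ⟨u, A, hu, hg, hA, hD⟩ := h
  exact ⟨u, hu, bondLetters_of_gauge335 T U hη hg hA hD⟩

end Generic

/-! ## §2 `𝔸 = M_n(ℂ)` (operator norm): the class's gauge is unitary; both letters for a `U(n)`-valued background -/

section MatrixOp

open scoped Matrix.Norms.L2Operator
open Literature.MathematicalPhysics.QuantumFieldTheory.Balaban1983to89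
open Literature.MathematicalPhysics.QuantumFieldTheory.Balaban1983to89.B9Eq39Adjoint (covD fluct)
open Literature.MathematicalPhysics.QuantumFieldTheory.Balaban1983to89.B9Eq3117Current (gaugeTr)
open Literature.MathematicalPhysics.QuantumFieldTheory.Balaban1983to89.B9Eq335RegularityClasses (Reg335Cube)

variable {n : Type} [Fintype n] [DecidableEq n] {X J : Type} (T : J → Equiv.Perm X) (U : J → X → (Matrix n n ℂ)ˣ)

/-- For a unit `w` of `M_n(ℂ)` whose value is unitary, the inverse unit's value is the conjugate transpose. [folklore] -/
theorem uN_val_inv_eq_conjTranspose {w : (Matrix n n ℂ)ˣ} (hw : (w : Matrix n n ℂ) ∈ Matrix.unitaryGroup n ℂ) :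
    (((w⁻¹ : (Matrix n n ℂ)ˣ)) : Matrix n n ℂ) = (w : Matrix n n ℂ)ᴴ :=
  Units.inv_eq_of_mul_eq_one_left (Matrix.mem_unitaryGroup_iff'.mp hw)

/-- In a unitary gauge the transformed bond variable is `U^u_κ(z) = u(z)U_κ(z)u(z + e_κ)ᴴ` (r06's `gaugeTr` read in the `…SpeciesUN` currency). [cite: Balaban1985BackgroundPropagators, (3.28) p.395] -/
theorem uN_val_gaugeTr_eq {u : X → (Matrix n n ℂ)ˣ} {κ : J} {z : X} (hu : (u (T κ z) : Matrix n n ℂ) ∈ Matrix.unitaryGroup n ℂ) :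
    (gaugeTr T u U κ z : Matrix n n ℂ) = (u z : Matrix n n ℂ) * (U κ z : Matrix n n ℂ) * ((u (T κ z) : Matrix n n ℂ))ᴴ := by
  rw [gaugeTr, Units.val_mul, Units.val_mul, uN_val_inv_eq_conjTranspose hu]

/-- ★★ **`𝔸 = M_n(ℂ)`, A GAUGE DATUM `(u, A)` AS IN THE CLASS ⟹ `u` IS UNITARY ON □ AND BOTH LETTERS HOLD (operator norm)** — `u`, `A` free: «`u` of unitary type on □» (`‖u‖_{op},
‖u⁻¹‖_{op} ≤ 1`), `U^u = e^{iηA}` on □, `‖A_κ‖ < Cξ⁻¹`, `‖η⁻¹D¹_κA_ν‖ < Cξ⁻²` on □, `η > 0` ⟹ `u(z) ∈ U(n)` for `z ∈ □` (§0),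
`‖U^u_κ(z) − 1‖_{op} ≤ η·(C∕ξ)e^{ηC∕ξ}` on □, `‖U^u_ν(z + e_κ) − U^u_ν(z)‖_{op} ≤ η²·(C∕ξ²)e^{ηC∕ξ}` for `z, z + e_κ ∈ □`, all `κ, ν` (§1; `‖1‖_{op} = 1`).
[cite: Balaban1985BackgroundPropagators, (3.35) p.396, Cor. 3.6 p.408] -/
theorem uN_opLetters_of_gauge335 [Nonempty n] {η : ℝ} (hη : 0 < η) {cube : Set X} {ξ C : ℝ} {u : X → (Matrix n n ℂ)ˣ} {A : J → X → Matrix n n ℂ}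
    (hu : ∀ z ∈ cube, ‖(u z : Matrix n n ℂ)‖ ≤ 1 ∧ ‖(((u z)⁻¹ : (Matrix n n ℂ)ˣ) : Matrix n n ℂ)‖ ≤ 1) (hg : ∀ κ, ∀ z ∈ cube, gaugeTr T u U κ z = fluct η A κ z)
    (hA : ∀ κ, ∀ z ∈ cube, ‖A κ z‖ < C * ξ⁻¹) (hD : ∀ κ ν, ∀ z ∈ cube, ‖((η : ℂ)⁻¹) • covD T (fun _ _ => (1 : (Matrix n n ℂ)ˣ)) κ (A ν) z‖ < C * (ξ ^ 2)⁻¹) :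
    (∀ z ∈ cube, (u z : Matrix n n ℂ) ∈ Matrix.unitaryGroup n ℂ) ∧
      (∀ κ, ∀ z ∈ cube, ‖(gaugeTr T u U κ z : Matrix n n ℂ) - 1‖ ≤ η * (C / ξ) * Real.exp (η * (C / ξ))) ∧
      (∀ κ ν, ∀ z ∈ cube, T κ z ∈ cube →
        ‖(gaugeTr T u U ν (T κ z) : Matrix n n ℂ) - gaugeTr T u U ν z‖ ≤ η ^ 2 * (C / ξ ^ 2) * Real.exp (η * (C / ξ))) :=
  ⟨fun z hz => uN_mem_unitaryGroup_of_norm_le_one (u z) (hu z hz).1 (hu z hz).2, bondLetters_of_gauge335 T U hη hg hA hD⟩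

/-- ★★ **THE CLASS (3.35) ON A CUBE, `𝔸 = M_n(ℂ)`, BY NAME ⟹ A UNITARY GAUGE WITH BOTH LETTERS (operator norm)** (∃-form): with the L²-operator norm on `M_n(ℂ)` (so that «`u` of unitary
type» MEANS unitary by §0, and `‖1‖ = 1`): `Reg335Cube T U η □ ξ C`, `η > 0` ⟹ ∃ `u`, unitary on □, with `‖U^u_κ(z) − 1‖_{op} ≤ η·(C∕ξ)e^{ηC∕ξ}` on □ and
`‖U^u_ν(z + e_κ) − U^u_ν(z)‖_{op} ≤ η²·(C∕ξ²)e^{ηC∕ξ}` for `z, z + e_κ ∈ □`, all `κ, ν`. [cite: Balaban1985BackgroundPropagators, (3.35) p.396, Cor. 3.6 p.408] -/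
theorem uN_exists_gauge_opLetters_of_reg335Cube [Nonempty n] {η : ℝ} (hη : 0 < η) {cube : Set X} {ξ C : ℝ}
    (h : Reg335Cube T U η cube ξ C) :
    ∃ u : X → (Matrix n n ℂ)ˣ, (∀ z ∈ cube, (u z : Matrix n n ℂ) ∈ Matrix.unitaryGroup n ℂ) ∧
      (∀ κ, ∀ z ∈ cube, ‖(gaugeTr T u U κ z : Matrix n n ℂ) - 1‖ ≤ η * (C / ξ) * Real.exp (η * (C / ξ))) ∧
      (∀ κ ν, ∀ z ∈ cube, T κ z ∈ cube →
        ‖(gaugeTr T u U ν (T κ z) : Matrix n n ℂ) - gaugeTr T u U ν z‖ ≤ η ^ 2 * (C / ξ ^ 2) * Real.exp (η * (C / ξ))) := by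
  obtain ⟨u, A, hu, hg, hA, hD⟩ := h
  exact ⟨u, uN_opLetters_of_gauge335 T U hη hu hg hA hD⟩

end MatrixOp

/-! ## §3 THE JUNCTION: (3.35) ⟹ g5 FILE 11's `hV` for the local species of `U^u`, both letters discharged -/

section Junction

open scoped Matrix.Norms.L2Operator
open Literature.MathematicalPhysics.QuantumFieldTheory.Balaban1983to89
open Literature.MathematicalPhysics.QuantumFieldTheory.Balaban1983to89.B11SectG (BlockNorm HasMaj)
open Literature.MathematicalPhysics.QuantumFieldTheory.Balaban1983to89.B9Eq39Adjoint (covD fluct)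
open Literature.MathematicalPhysics.QuantumFieldTheory.Balaban1983to89.B9Eq3117Current (gaugeTr)
open Literature.MathematicalPhysics.QuantumFieldTheory.Balaban1983to89.B9Eq335RegularityClasses (Reg335Cube)
open Literature.MathematicalPhysics.QuantumFieldTheory.Balaban1983to89.B9Eq335PureGaugeInClassAtLettersY (reg335Cube_gaugeTr_one)
open Summit.QuantumFields.YangMills.BalabanUVNodes.N15.MatrixSpecies (liftBlk coordMat basisConst basisConst_nonneg)
open Summit.QuantumFields.YangMills.BalabanUVNodes.N15.BackgroundLayer (tCoefA tCoefC unstackM blkPair)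
open Literature.Barriers.QuantumFields (traceForm)

variable {n : Type} [Fintype n] [DecidableEq n] [Nonempty n] {κ : Type} [Fintype κ] [DecidableEq κ] (e : Matrix n n ℂ ≃L[ℝ] (κ → ℝ))
variable {X J : Type} [Fintype X] [Fintype J] (τ : J → X ≃ X) (U : J → X → (Matrix n n ℂ)ˣ)

/-- ★★★ **THE JUNCTION FOR A GAUGE DATUM `(u, A)` AS IN THE CLASS (3.35), `u`, `A` FREE.**  A `U(n)`-valued bond field `U` on the cube device's carrier `X` (shifts `τ`) with a gauge
datum on the WHOLE carrier — `u` of unitary type (`‖u‖_{op}, ‖u⁻¹‖_{op} ≤ 1`), `U^u = e^{iηA}`, `‖A_μ‖_{op} < Cξ⁻¹`, `‖η⁻¹D¹_μA_ν‖_{op} < Cξ⁻²` —, `η > 0`, `C ≥ 0`, `d(y, y) = 0` ⟹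
`u` is unitary and the local species `unstackM (tCoefC η Rp) (tCoefA η Rp)` of the transformed bond variables `U^u_μ(x) = u(x)U_μ(x)u(x + e_μ)ᴴ` (`Rp = gaugePair τ (R_U)^{W_u}`,
`W_u = coordMat e (Ad_u)`) obeys g5 FILE 11's `hV` letter `curvRowLetter κ J (κ_e·2√|n|·a) (κ_e·2√|n|·b)·(1 + |J ⊕ J|)·e^{−δ_V d}` for EVERY `δ_V`, with
`a := √|n|·(C∕ξ)·e^{ηC∕ξ}`, `b := √|n|·(C∕ξ²)·e^{ηC∕ξ}` (`κ_e` = the lineage's Frobenius-currency `basisConst e`, written with its instances since this section's norm is the operator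
norm): §2's letters, `‖·‖_F ≤ √|n|·‖·‖_{op}` (g5 FILE 3), FILE 11 `uN_hasMaj_localSpecies_rate` verbatim (its second letter = §2's along the own direction at `z = x − e_μ`).
[cite: Balaban1985BackgroundPropagators, (3.35) p.396, Thm 3.1 p.397, (3.52)–(3.53) p.400, Cor. 3.6 p.408] -/
theorem uN_hasMaj_localSpecies_rate_of_gauge335 (he : ∀ A B : Matrix n n ℂ, traceForm A B = e A ⬝ᵥ e B) {g : B6.Geometry} (blk : X → g.Site)
    (hd0 : ∀ y : g.Site, g.dist y y = 0) {η : ℝ} (hη : 0 < η) (hU : ∀ μ x, (U μ x : Matrix n n ℂ) ∈ Matrix.unitaryGroup n ℂ) {ξ C : ℝ} (hξ : 0 < ξ) (hC : 0 ≤ C)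
    {u : X → (Matrix n n ℂ)ˣ} {A : J → X → Matrix n n ℂ} (hu1 : ∀ x, ‖(u x : Matrix n n ℂ)‖ ≤ 1 ∧ ‖(((u x)⁻¹ : (Matrix n n ℂ)ˣ) : Matrix n n ℂ)‖ ≤ 1)
    (hg : ∀ μ x, gaugeTr τ u U μ x = fluct η A μ x) (hA : ∀ μ x, ‖A μ x‖ < C * ξ⁻¹)
    (hD : ∀ μ ν x, ‖((η : ℂ)⁻¹) • covD τ (fun _ _ => (1 : (Matrix n n ℂ)ˣ)) μ (A ν) x‖ < C * (ξ ^ 2)⁻¹) (δV : ℝ) :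
    (∀ x, (u x : Matrix n n ℂ) ∈ Matrix.unitaryGroup n ℂ) ∧
      HasMaj (BlockNorm.ofBlocks g (blkPair (liftBlk blk κ))) (BlockNorm.ofBlocks g (liftBlk blk κ))
        (unstackM (tCoefC η (gaugePair τ (trGaugeActFwd τ (fun x => coordMat e (ContinuousLinearMap.mulLeftRight ℝ (Matrix n n ℂ) (u x : Matrix n n ℂ) (u x : Matrix n n ℂ)ᴴ))
              (fun μ x => coordMat e (ContinuousLinearMap.mulLeftRight ℝ (Matrix n n ℂ) (U μ x : Matrix n n ℂ) (U μ x : Matrix n n ℂ)ᴴ)))))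
          (tCoefA η (gaugePair τ (trGaugeActFwd τ (fun x => coordMat e (ContinuousLinearMap.mulLeftRight ℝ (Matrix n n ℂ) (u x : Matrix n n ℂ) (u x : Matrix n n ℂ)ᴴ))
              (fun μ x => coordMat e (ContinuousLinearMap.mulLeftRight ℝ (Matrix n n ℂ) (U μ x : Matrix n n ℂ) (U μ x : Matrix n n ℂ)ᴴ))))))
        (fun y y' => curvRowLetter κ J
            (@basisConst κ _ (Matrix n n ℂ) Matrix.frobeniusNormedAddCommGroup Matrix.frobeniusNormedSpace e * (2 * Real.sqrt (Fintype.card n)) *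
              (Real.sqrt (Fintype.card n) * ((C / ξ) * Real.exp (η * (C / ξ)))))
            (@basisConst κ _ (Matrix n n ℂ) Matrix.frobeniusNormedAddCommGroup Matrix.frobeniusNormedSpace e * (2 * Real.sqrt (Fintype.card n)) *
              (Real.sqrt (Fintype.card n) * ((C / ξ ^ 2) * Real.exp (η * (C / ξ))))) * (1 + Fintype.card (J ⊕ J)) *
          Real.exp (-(δV * g.dist y y'))) := by
  obtain ⟨huU, h1, h2⟩ := uN_opLetters_of_gauge335 (T := τ) U (cube := Set.univ) hη (fun z _ => hu1 z) (fun μ z _ => hg μ z) (fun μ z _ => hA μ z)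
    (fun μ ν z _ => hD μ ν z)
  have hu : ∀ x, (u x : Matrix n n ℂ) ∈ Matrix.unitaryGroup n ℂ := fun x => huU x (Set.mem_univ x)
  have hu' : ∀ x, (u x : Matrix n n ℂ)ᴴ * (u x : Matrix n n ℂ) = 1 := fun x => Matrix.mem_unitaryGroup_iff'.mp (hu x)
  have hU' : ∀ μ x, (U μ x : Matrix n n ℂ)ᴴ * (U μ x : Matrix n n ℂ) = 1 := fun μ x => Matrix.mem_unitaryGroup_iff'.mp (hU μ x)
  have hsq : 0 ≤ Real.sqrt (Fintype.card n) := Real.sqrt_nonneg _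
  have ha0 : 0 ≤ Real.sqrt (Fintype.card n) * ((C / ξ) * Real.exp (η * (C / ξ))) := by positivity
  have hb0 : 0 ≤ Real.sqrt (Fintype.card n) * ((C / ξ ^ 2) * Real.exp (η * (C / ξ))) := by positivity
  -- the transformed bond variables in the `…SpeciesUN` currency
  have hval : ∀ μ x, (gaugeTr τ u U μ x : Matrix n n ℂ) = (u x : Matrix n n ℂ) * (U μ x : Matrix n n ℂ) * ((u (τ μ x) : Matrix n n ℂ))ᴴ :=
    fun μ x => uN_val_gaugeTr_eq (T := τ) U (hu (τ μ x))
  refine ⟨hu, uN_hasMaj_localSpecies_rate e τ (fun x => (u x : Matrix n n ℂ)) (fun μ x => (U μ x : Matrix n n ℂ)) blk η he hu' hU' hd0 hη ha0 hb0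
    (fun μ x => ?_) (fun μ x => ?_) δV⟩
  · -- first letter, Frobenius ≤ √|n| · operator
    have hop := h1 μ x (Set.mem_univ x)
    rw [hval] at hop
    refine (frobenius_norm_le_sqrt_card_mul_l2_opNorm _).trans ?_
    calc Real.sqrt (Fintype.card n) * ‖(u x : Matrix n n ℂ) * (U μ x : Matrix n n ℂ) * ((u (τ μ x) : Matrix n n ℂ))ᴴ - 1‖
        ≤ Real.sqrt (Fintype.card n) * (η * (C / ξ) * Real.exp (η * (C / ξ))) := mul_le_mul_of_nonneg_left hop hsq
      _ = η * (Real.sqrt (Fintype.card n) * ((C / ξ) * Real.exp (η * (C / ξ)))) := by ring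
  · -- second letter along the own direction: `z := τ_μ⁻¹ x`, `κ = ν = μ`
    have hop := h2 μ μ ((τ μ).symm x) (Set.mem_univ _) (Set.mem_univ _)
    rw [Equiv.apply_symm_apply, hval, hval] at hop
    refine (frobenius_norm_le_sqrt_card_mul_l2_opNorm _).trans ?_
    calc Real.sqrt (Fintype.card n) *
          ‖(u x : Matrix n n ℂ) * (U μ x : Matrix n n ℂ) * ((u (τ μ x) : Matrix n n ℂ))ᴴ -
              (u ((τ μ).symm x) : Matrix n n ℂ) * (U μ ((τ μ).symm x) : Matrix n n ℂ) * ((u (τ μ ((τ μ).symm x)) : Matrix n n ℂ))ᴴ‖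
        ≤ Real.sqrt (Fintype.card n) * (η ^ 2 * (C / ξ ^ 2) * Real.exp (η * (C / ξ))) := mul_le_mul_of_nonneg_left hop hsq
      _ = η ^ 2 * (Real.sqrt (Fintype.card n) * ((C / ξ ^ 2) * Real.exp (η * (C / ξ)))) := by ring

/-- ★★★ **THE JUNCTION — PRINT's CLASS (3.35) BY NAME FEEDS THE CUBE DEVICE's PERTURBATION LETTER, BOTH INEQUALITIES DISCHARGED** (∃-form): a `U(n)`-valued bond field `U` on the
cube device's carrier `X` (shifts `τ`) in r06's class `Reg335Cube τ U η univ ξ C` (`𝔸 = M_n(ℂ)` with the operator norm; «there exists a gauge transformation u on □ such that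
U^u = e^{iηA} … |A| < Cξ⁻¹, |∇^ηA| < Cξ⁻² on □», □ = the carrier), `η, ξ > 0`, `C ≥ 0`, `d(y, y) = 0` ⟹ there is a UNITARY site gauge `u` (the class's own) in which the local species of
`U^u` obeys g5 FILE 11's `hV` letter for EVERY `δ_V` with `a := √|n|·(C∕ξ)e^{ηC∕ξ}`, `b := √|n|·(C∕ξ²)e^{ηC∕ξ}`.  FILE 11's displayed SECOND letter is thereby DISCHARGED from (3.35) by
name; the class itself remains the hypothesis, exactly as in [B9] Thm 3.1 («for an arbitrary configuration U satisfying the regularity condition (3.35)»).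
[cite: Balaban1985BackgroundPropagators, (3.35) p.396, Thm 3.1 p.397, (3.52)–(3.53) p.400, Cor. 3.6 p.408] -/
theorem uN_exists_gauge_hasMaj_localSpecies_rate_of_reg335Cube (he : ∀ A B : Matrix n n ℂ, traceForm A B = e A ⬝ᵥ e B) {g : B6.Geometry} (blk : X → g.Site)
    (hd0 : ∀ y : g.Site, g.dist y y = 0) {η : ℝ} (hη : 0 < η) (hU : ∀ μ x, (U μ x : Matrix n n ℂ) ∈ Matrix.unitaryGroup n ℂ) {ξ C : ℝ} (hξ : 0 < ξ) (hC : 0 ≤ C)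
    (h : Reg335Cube τ U η Set.univ ξ C) (δV : ℝ) :
    ∃ u : X → (Matrix n n ℂ)ˣ, (∀ x, (u x : Matrix n n ℂ) ∈ Matrix.unitaryGroup n ℂ) ∧
      HasMaj (BlockNorm.ofBlocks g (blkPair (liftBlk blk κ))) (BlockNorm.ofBlocks g (liftBlk blk κ))
        (unstackM (tCoefC η (gaugePair τ (trGaugeActFwd τ (fun x => coordMat e (ContinuousLinearMap.mulLeftRight ℝ (Matrix n n ℂ) (u x : Matrix n n ℂ) (u x : Matrix n n ℂ)ᴴ))
              (fun μ x => coordMat e (ContinuousLinearMap.mulLeftRight ℝ (Matrix n n ℂ) (U μ x : Matrix n n ℂ) (U μ x : Matrix n n ℂ)ᴴ)))))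
          (tCoefA η (gaugePair τ (trGaugeActFwd τ (fun x => coordMat e (ContinuousLinearMap.mulLeftRight ℝ (Matrix n n ℂ) (u x : Matrix n n ℂ) (u x : Matrix n n ℂ)ᴴ))
              (fun μ x => coordMat e (ContinuousLinearMap.mulLeftRight ℝ (Matrix n n ℂ) (U μ x : Matrix n n ℂ) (U μ x : Matrix n n ℂ)ᴴ))))))
        (fun y y' => curvRowLetter κ J
            (@basisConst κ _ (Matrix n n ℂ) Matrix.frobeniusNormedAddCommGroup Matrix.frobeniusNormedSpace e * (2 * Real.sqrt (Fintype.card n)) *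
              (Real.sqrt (Fintype.card n) * ((C / ξ) * Real.exp (η * (C / ξ)))))
            (@basisConst κ _ (Matrix n n ℂ) Matrix.frobeniusNormedAddCommGroup Matrix.frobeniusNormedSpace e * (2 * Real.sqrt (Fintype.card n)) *
              (Real.sqrt (Fintype.card n) * ((C / ξ ^ 2) * Real.exp (η * (C / ξ))))) * (1 + Fintype.card (J ⊕ J)) *
          Real.exp (-(δV * g.dist y y'))) := by
  obtain ⟨u, A, hu, hg, hA, hD⟩ := h
  exact ⟨u, uN_hasMaj_localSpecies_rate_of_gauge335 e τ U he blk hd0 hη hU hξ hC (fun x => hu x (Set.mem_univ x)) (fun μ x => hg μ x (Set.mem_univ x))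
    (fun μ x => hA μ x (Set.mem_univ x)) (fun μ ν x => hD μ ν x (Set.mem_univ x)) δV⟩

/-! ## §4 A6: the junction's hypothesis set is inhabited (pure gauges of unitary site fields) -/

omit [Fintype X] in
/-- **NON-VACUITY (A6)**: every PURE GAUGE `U = (1)^v = (v(x)·v(x + e_μ)⁻¹)`, `v` unitary, is in r06's class (3.35) on every cube for all `ξ, C > 0` (`reg335Cube_gaugeTr_one` BY NAME;
unitary ⟹ unitary type by `CStarRing.norm_of_mem_unitary`), and is `U(n)`-valued — so on the cube device's carrier the junction `uN_exists_gauge_hasMaj_localSpecies_rate_of_reg335Cube`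
FIRES at genuinely non-constant `U(n)` configurations (the conclusion there is what it is; no claim beyond inhabitation). [cite: Balaban1985BackgroundPropagators, (3.35) p.396, (3.28) p.395] -/
theorem uN_reg335Cube_pureGauge [LinearOrder J] (v : X → (Matrix n n ℂ)ˣ) (hv : ∀ x, (v x : Matrix n n ℂ) ∈ Matrix.unitaryGroup n ℂ) {η : ℝ} (cube : Set X) {ξ C : ℝ}
    (hξ : 0 < ξ) (hC : 0 < C) :
    Reg335Cube τ (gaugeTr τ v (fun _ _ => (1 : (Matrix n n ℂ)ˣ))) η cube ξ C ∧
      ∀ μ x, (gaugeTr τ v (fun _ _ => (1 : (Matrix n n ℂ)ˣ)) μ x : Matrix n n ℂ) ∈ Matrix.unitaryGroup n ℂ := by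
  have hv1 : ∀ x, ‖(v x : Matrix n n ℂ)‖ ≤ 1 ∧ ‖(((v x)⁻¹ : (Matrix n n ℂ)ˣ) : Matrix n n ℂ)‖ ≤ 1 := fun x =>
    ⟨(CStarRing.norm_of_mem_unitary (hv x)).le, by
      rw [uN_val_inv_eq_conjTranspose (hv x)]
      exact (CStarRing.norm_of_mem_unitary (Unitary.star_mem (hv x))).le⟩
  refine ⟨reg335Cube_gaugeTr_one τ cube hξ hC v fun z _ => hv1 z, fun μ x => ?_⟩
  rw [uN_val_gaugeTr_eq (T := τ) (fun _ _ => (1 : (Matrix n n ℂ)ˣ)) (hv (τ μ x)), Units.val_one, mul_one]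
  exact Submonoid.mul_mem _ (hv x) (Unitary.star_mem (hv (τ μ x)))

end Junction

end Summit.QuantumFields.YangMills.BalabanUVNodes.N15.CurvedSpecies

end
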